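import Summits.AtomisticToContinuum.FouriersLaw.Theorems.OddSectorIrreversibilityResponseDensityResponseIdentity

/-!
# The exact response identity of the pinned chain (infinite time)

Helper file for item stmt-AtomisticToContinuum-9144 (`ResponseDensity`, route
`OddSectorIrreversibility`, sub-problem `FouriersLaw` of `AtomisticToContinuum`).

Letting `t → ∞` in the finite-time response identity (`…ResponseDensityResponseIdentity.lean`) with the
exponential convergence (2.5) of the transition semigroup (`pinnedChainSemigroup_ergodic`): for baths at
`T ± δ/2`, every invariant probability measure `μ⋆` of the semigroup and every `φ ∈ C²` with
`|φ| ≤ C e^{ϑH}`,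

  `(∫ e^{-H/T} dx) · μ⋆(φ) - ∫ e^{-H/T} φ dx = δ (γ/2T²) ∫₀^∞ ∫ P_s φ · e^{-H/T}(p_0² - p_{N-1}²) dx ds`

(`pinnedChain_exact_response_identity`) — an exact, non-perturbative fluctuation–response relation: the
steady-state shift of `μ⋆(φ)` from its equilibrium value is `δ γ/(2T²)` times the time-integrated
correlation, under the NON-equilibrium dynamics started from the equilibrium Gibbs state at the mean
temperature, between the kinetic-temperature imbalance of the two contact momenta and `φ`.
No definitions.
-/

noncomputable section

open MeasureTheory ProbabilityTheory Filter Topology Set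
open scoped NNReal ENNReal ContDiff

namespace Summit.AtomisticToContinuum.FouriersLaw.Theorems

open Literature.MathematicalPhysics.KineticTheory.HeatConduction
open Literature.Probability.Process Literature.MathematicalPhysics.KineticTheory OscillatorChain

variable {N : ℕ}

section InfiniteTime

variable {ω₂ lam β γ : ℝ} (hω : 0 < ω₂) (hl : 0 ≤ lam) (hβ : 0 < β) (hγ : 0 < γ)
  (hN : 0 < N) {T δ : ℝ} (hT : 0 < T) (hTL : 0 < T + δ / 2) (hTR : 0 < T - δ / 2)
  {ϑ : ℝ} (hϑ : 0 < ϑ) (hϑ' : ϑ < 1 / max (T + δ / 2) (T - δ / 2))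
  {φ : PhaseSpace N → ℝ} (hφ2 : ContDiff ℝ 2 φ) {C : ℝ}
  (hφ : ∀ y, |φ y| ≤ C * Real.exp (ϑ * (pinnedChain ω₂ lam β γ).hamiltonian N y))
include hω hl hβ hγ hN hT hTL hTR hϑ hϑ' hφ2 hφ

/-- **The exact response identity of the pinned chain.** For baths at `T ± δ/2` (both positive),
every invariant probability measure `μ⋆` of the transition semigroup and every `φ ∈ C²` with
`|φ| ≤ C e^{ϑH}` (`0 < ϑ < 1/max(T_L, T_R)`):

  `(∫ e^{-H/T} dx) · μ⋆(φ) - ∫ e^{-H/T} φ dx = δ (γ/2T²) ∫₀^∞ ∫ P_s φ · e^{-H/T}(p_0² - p_{N-1}²) dx ds`,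

i.e. (dividing by the partition function) `μ⋆(φ) - π_T(φ) = δ (γ/2T²) ∫₀^∞ π_T((p_0² - p_{N-1}²) P_s φ) ds`
with `π_T` the Gibbs measure at the mean temperature: the shift of the steady-state expectation is
`δ γ/(2T²)` times the time-integrated correlation — under the NON-equilibrium dynamics started from
the equilibrium `π_T` — between the kinetic temperature imbalance of the two contact momenta at time
`0` and `φ` at time `s`. The time integral converges absolutely (exponential convergence (2.5),
`pinnedChainSemigroup_ergodic`). At `δ = 0` it says that `π_T` is invariant for the semigroup. -/
theorem pinnedChain_exact_response_identity (μs : Measure (PhaseSpace N)) [IsProbabilityMeasure μs]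
    (hinv : (pinnedChainSemigroup hω hl hβ.le hγ.le hN hTL.le hTR.le).IsInvariant μs) :
    (∫ x : PhaseSpace N, Real.exp (-1 / T * (pinnedChain ω₂ lam β γ).hamiltonian N x)) *
          (∫ y, φ y ∂μs) -
        ∫ x, Real.exp (-1 / T * (pinnedChain ω₂ lam β γ).hamiltonian N x) * φ x =
      δ * (γ / (2 * T ^ 2)) * ∫ s in Ioi (0 : ℝ),
        ∫ x, (∫ y, φ y ∂((pinnedChain ω₂ lam β γ).transitionKernel N (T + δ / 2) (T - δ / 2)
            s.toNNReal x)) *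
          (Real.exp (-1 / T * (pinnedChain ω₂ lam β γ).hamiltonian N x) *
            (x.2 ⟨0, hN⟩ ^ 2 - x.2 ⟨N - 1, by omega⟩ ^ 2)) := by
  have hθϑ := neg_inv_add_lt_zero hT hϑ' (δ := δ)
  have hHc : Continuous ((pinnedChain ω₂ lam β γ).hamiltonian N) := (pinnedChain_contDiff_hamiltonian ω₂ lam β γ N (n := 0)).continuous
  have hφc : Continuous φ := hφ2.continuous
  have hC : 0 ≤ C := by
    have := (abs_nonneg _).trans (hφ 0)
    exact nonneg_of_mul_nonneg_left this (Real.exp_pos _)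
  -- the ergodic theorem: uniqueness of the invariant measure and exponential convergence (2.5)
  obtain ⟨huniq, μs', hμs', hinv', hrest⟩ := pinnedChainSemigroup_ergodic hω hl hβ hγ hN hTL hTR
  have hμ : μs = μs' := huniq μs μs' inferInstance hμs' hinv hinv'
  obtain ⟨-, Cm, c, hCm, hc, hmix⟩ := hrest ϑ hϑ hϑ'
  -- (2.5) for `φ` (rescaled by `M = max C 1`)
  set M : ℝ := max C 1 with hM
  have hM0 : 0 < M := lt_max_of_lt_right one_pos
  have hmixφ : ∀ (t : ℝ≥0) (z : PhaseSpace N),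
      |(∫ y, φ y ∂((pinnedChain ω₂ lam β γ).transitionKernel N (T + δ / 2) (T - δ / 2) t z)) - ∫ y, φ y ∂μs| ≤
        M * Cm * Real.exp (ϑ * (pinnedChain ω₂ lam β γ).hamiltonian N z) * Real.exp (-c * t) := by
    intro t z
    have hf : ∀ y, |φ y / M| ≤ Real.exp (ϑ * (pinnedChain ω₂ lam β γ).hamiltonian N y) := fun y => by
      rw [abs_div, abs_of_pos hM0, div_le_iff₀ hM0]
      calc |φ y| ≤ C * Real.exp (ϑ * (pinnedChain ω₂ lam β γ).hamiltonian N y) := hφ y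
        _ ≤ M * Real.exp (ϑ * (pinnedChain ω₂ lam β γ).hamiltonian N y) := mul_le_mul_of_nonneg_right (le_max_left _ _) (Real.exp_pos _).le
        _ = Real.exp (ϑ * (pinnedChain ω₂ lam β γ).hamiltonian N y) * M := mul_comm _ _
    have h := hmix z t (fun y => φ y / M) (hφc.div_const M) hf
    rw [LangevinChainSemigroup.act_apply, pinnedChainSemigroup_kernel, integral_div, integral_div,
      ← sub_div, abs_div, abs_of_pos hM0, div_le_iff₀ hM0, ← hμ] at h
    calc _ ≤ Cm * Real.exp (ϑ * (pinnedChain ω₂ lam β γ).hamiltonian N z) * Real.exp (-c * t) * M := h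
      _ = _ := by ring
  -- Step A: the Gibbs pairing converges to `Z μ⋆(φ)`
  have hI₁ := integrable_exp_mul_hamiltonian hω hl hβ.le γ (N := N) hθϑ
  have hIθ := integrable_exp_mul_hamiltonian hω hl hβ.le γ (N := N) (c := -1 / T)
    (by rw [neg_div]; exact neg_neg_of_pos (one_div_pos.2 hT))
  have hexp0 : Tendsto (fun t : ℝ≥0 => Real.exp (-c * t)) atTop (𝓝 0) := by
    have h1 : Tendsto (fun t : ℝ≥0 => (t : ℝ)) atTop atTop := NNReal.tendsto_coe_atTop.2 tendsto_id
    have h2 : Tendsto (fun t : ℝ≥0 => -c * (t : ℝ)) atTop atBot := by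
      refine (tendsto_neg_atTop_atBot.comp (h1.const_mul_atTop hc)).congr fun t => ?_
      exact (neg_mul c (t : ℝ)).symm
    exact Real.tendsto_exp_atBot.comp h2
  set B : ℝ := M * Cm * ∫ x : PhaseSpace N, Real.exp ((-1 / T + ϑ) * (pinnedChain ω₂ lam β γ).hamiltonian N x) with hB
  have hA : Tendsto (fun t : ℝ≥0 => ∫ x, Real.exp (-1 / T * (pinnedChain ω₂ lam β γ).hamiltonian N x) *
      ∫ y, φ y ∂((pinnedChain ω₂ lam β γ).transitionKernel N (T + δ / 2) (T - δ / 2) t x)) atTop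
      (𝓝 ((∫ x : PhaseSpace N, Real.exp (-1 / T * (pinnedChain ω₂ lam β γ).hamiltonian N x)) * ∫ y, φ y ∂μs)) := by
    rw [← integral_mul_const]
    have hB0 : Tendsto (fun t : ℝ≥0 => B * Real.exp (-c * t)) atTop (𝓝 0) := by
      have := hexp0.const_mul B
      rwa [mul_zero] at this
    refine tendsto_iff_norm_sub_tendsto_zero.2 (squeeze_zero (fun t => norm_nonneg _) (fun t => ?_) hB0)
    rw [← integral_sub (integrable_gibbsWeight_mul_forecast hω hl hβ.le hγ hN hT hTL hTR hϑ hϑ' hφ2 hφ t)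
      (hIθ.mul_const _)]
    have hbd : ∀ x : PhaseSpace N, ‖Real.exp (-1 / T * (pinnedChain ω₂ lam β γ).hamiltonian N x) *
        (∫ y, φ y ∂((pinnedChain ω₂ lam β γ).transitionKernel N (T + δ / 2) (T - δ / 2) t x)) -
        Real.exp (-1 / T * (pinnedChain ω₂ lam β γ).hamiltonian N x) * ∫ y, φ y ∂μs‖ ≤
        M * Cm * Real.exp (-c * t) * Real.exp ((-1 / T + ϑ) * (pinnedChain ω₂ lam β γ).hamiltonian N x) := by
      intro x
      rw [← mul_sub, norm_mul, Real.norm_eq_abs, Real.norm_eq_abs, abs_of_pos (Real.exp_pos _),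
        show (-1 / T + ϑ) * (pinnedChain ω₂ lam β γ).hamiltonian N x = -1 / T * (pinnedChain ω₂ lam β γ).hamiltonian N x + ϑ * (pinnedChain ω₂ lam β γ).hamiltonian N x by ring, Real.exp_add]
      calc _ ≤ Real.exp (-1 / T * (pinnedChain ω₂ lam β γ).hamiltonian N x) * (M * Cm * Real.exp (ϑ * (pinnedChain ω₂ lam β γ).hamiltonian N x) * Real.exp (-c * t)) :=
            mul_le_mul_of_nonneg_left (hmixφ t x) (Real.exp_pos _).le
        _ = _ := by ring
    calc _ ≤ ∫ x : PhaseSpace N, M * Cm * Real.exp (-c * t) * Real.exp ((-1 / T + ϑ) * (pinnedChain ω₂ lam β γ).hamiltonian N x) :=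
          norm_integral_le_of_norm_le (hI₁.const_mul _) (Eventually.of_forall hbd)
      _ = B * Real.exp (-c * t) := by rw [integral_const_mul, hB]; ring
  -- the finite-time identity, as a function of `t`
  have hfin := fun t : ℝ≥0 =>
    pinnedChain_finite_time_response_identity hω hl hβ.le hγ hN hT hTL hTR hϑ hϑ' hφ2 hφ t
  have hA' : Tendsto (fun t : ℝ≥0 => δ * (γ / (2 * T ^ 2)) * ∫ s in (0 : ℝ)..t,
      ∫ x, (∫ y, φ y ∂((pinnedChain ω₂ lam β γ).transitionKernel N (T + δ / 2) (T - δ / 2) s.toNNReal x)) *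
        (Real.exp (-1 / T * (pinnedChain ω₂ lam β γ).hamiltonian N x) * (x.2 ⟨0, hN⟩ ^ 2 - x.2 ⟨N - 1, by omega⟩ ^ 2))) atTop
      (𝓝 ((∫ x : PhaseSpace N, Real.exp (-1 / T * (pinnedChain ω₂ lam β γ).hamiltonian N x)) * (∫ y, φ y ∂μs) -
        ∫ x, Real.exp (-1 / T * (pinnedChain ω₂ lam β γ).hamiltonian N x) * φ x)) := by
    simp_rw [← hfin]
    exact hA.sub_const _
  -- Step B: `δ = 0` is trivial; for `δ ≠ 0` the odd-moment pairing is integrable on `(0, ∞)`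
  rcases eq_or_ne δ 0 with hδ | hδ
  · have h0 : Tendsto (fun t : ℝ≥0 => δ * (γ / (2 * T ^ 2)) * ∫ s in (0 : ℝ)..t,
        ∫ x, (∫ y, φ y ∂((pinnedChain ω₂ lam β γ).transitionKernel N (T + δ / 2) (T - δ / 2) s.toNNReal x)) *
          (Real.exp (-1 / T * (pinnedChain ω₂ lam β γ).hamiltonian N x) * (x.2 ⟨0, hN⟩ ^ 2 - x.2 ⟨N - 1, by omega⟩ ^ 2))) atTop
        (𝓝 0) := by
      simp only [hδ, zero_mul]
      exact tendsto_const_nhds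
    rw [tendsto_nhds_unique hA' h0, hδ, zero_mul, zero_mul]
  have hG₀ := integral_gibbsWeight_oddMoment_eq_zero hω hl hβ.le hγ hN hT hTL hTR hϑ hϑ' (N := N) hδ
  have hIw := integrable_momentSq_mul_exp_mul_hamiltonian hω hl hβ.le γ hN hθϑ
  set B' : ℝ := M * Cm * ∫ x : PhaseSpace N, (1 + x.2 ⟨0, hN⟩ ^ 2 + x.2 ⟨N - 1, by omega⟩ ^ 2) *
    Real.exp ((-1 / T + ϑ) * (pinnedChain ω₂ lam β γ).hamiltonian N x) with hB'
  -- pointwise bound of the odd-moment pairing for `s > 0`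
  have hbound : ∀ s : ℝ, 0 < s →
      ‖∫ x, (∫ y, φ y ∂((pinnedChain ω₂ lam β γ).transitionKernel N (T + δ / 2) (T - δ / 2) s.toNNReal x)) *
          (Real.exp (-1 / T * (pinnedChain ω₂ lam β γ).hamiltonian N x) * (x.2 ⟨0, hN⟩ ^ 2 - x.2 ⟨N - 1, by omega⟩ ^ 2))‖ ≤
        B' * Real.exp (-c * s) := by
    intro s hs
    have hIs := integrable_forecast_mul_oddMoment hω hl hβ.le hγ hN hT hTL hTR hϑ hϑ' hφ2 hφ s.toNNReal
    -- subtract `μ⋆(φ) · ∫ e^{-H/T}(p_0² - p_l²) = 0`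
    have hw : Integrable (fun x : PhaseSpace N => Real.exp (-1 / T * (pinnedChain ω₂ lam β γ).hamiltonian N x) *
        (x.2 ⟨0, hN⟩ ^ 2 - x.2 ⟨N - 1, by omega⟩ ^ 2)) := by
      have h1 := integrable_momentSq_mul_exp_mul_hamiltonian hω hl hβ.le γ hN (c := -1 / T)
        (by rw [neg_div]; exact neg_neg_of_pos (one_div_pos.2 hT))
      refine h1.mono' ((Real.continuous_exp.comp (continuous_const.mul hHc)).mul
        ((((continuous_apply _).comp continuous_snd).pow 2).sub
          (((continuous_apply _).comp continuous_snd).pow 2))).aestronglyMeasurable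
        (Eventually.of_forall fun x => ?_)
      rw [Real.norm_eq_abs, abs_mul, abs_of_pos (Real.exp_pos _), mul_comm]
      refine mul_le_mul_of_nonneg_right ?_ (Real.exp_pos _).le
      have h1 : 0 ≤ x.2 ⟨0, hN⟩ ^ 2 := sq_nonneg _
      have h2 : 0 ≤ x.2 ⟨N - 1, by omega⟩ ^ 2 := sq_nonneg _
      rw [abs_le]; constructor <;> linarith
    have hsub : (∫ x, (∫ y, φ y ∂((pinnedChain ω₂ lam β γ).transitionKernel N (T + δ / 2) (T - δ / 2) s.toNNReal x)) *
        (Real.exp (-1 / T * (pinnedChain ω₂ lam β γ).hamiltonian N x) * (x.2 ⟨0, hN⟩ ^ 2 - x.2 ⟨N - 1, by omega⟩ ^ 2))) =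
        ∫ x, ((∫ y, φ y ∂((pinnedChain ω₂ lam β γ).transitionKernel N (T + δ / 2) (T - δ / 2) s.toNNReal x)) - ∫ y, φ y ∂μs) *
          (Real.exp (-1 / T * (pinnedChain ω₂ lam β γ).hamiltonian N x) * (x.2 ⟨0, hN⟩ ^ 2 - x.2 ⟨N - 1, by omega⟩ ^ 2)) := by
      simp_rw [sub_mul]
      rw [integral_sub hIs (hw.const_mul _), integral_const_mul, hG₀, mul_zero, sub_zero]
    rw [hsub]
    have hbd : ∀ x : PhaseSpace N,
        ‖((∫ y, φ y ∂((pinnedChain ω₂ lam β γ).transitionKernel N (T + δ / 2) (T - δ / 2) s.toNNReal x)) - ∫ y, φ y ∂μs) *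
          (Real.exp (-1 / T * (pinnedChain ω₂ lam β γ).hamiltonian N x) * (x.2 ⟨0, hN⟩ ^ 2 - x.2 ⟨N - 1, by omega⟩ ^ 2))‖ ≤
        M * Cm * Real.exp (-c * s) *
          ((1 + x.2 ⟨0, hN⟩ ^ 2 + x.2 ⟨N - 1, by omega⟩ ^ 2) * Real.exp ((-1 / T + ϑ) * (pinnedChain ω₂ lam β γ).hamiltonian N x)) := by
      intro x
      have hm := hmixφ s.toNNReal x
      rw [Real.coe_toNNReal _ hs.le] at hm
      have hp : |x.2 ⟨0, hN⟩ ^ 2 - x.2 ⟨N - 1, by omega⟩ ^ 2| ≤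
          1 + x.2 ⟨0, hN⟩ ^ 2 + x.2 ⟨N - 1, by omega⟩ ^ 2 := by
        have h1 : 0 ≤ x.2 ⟨0, hN⟩ ^ 2 := sq_nonneg _
        have h2 : 0 ≤ x.2 ⟨N - 1, by omega⟩ ^ 2 := sq_nonneg _
        rw [abs_le]; constructor <;> linarith
      rw [norm_mul, norm_mul, Real.norm_eq_abs, Real.norm_eq_abs, Real.norm_eq_abs,
        abs_of_pos (Real.exp_pos _),
        show (-1 / T + ϑ) * (pinnedChain ω₂ lam β γ).hamiltonian N x = -1 / T * (pinnedChain ω₂ lam β γ).hamiltonian N x + ϑ * (pinnedChain ω₂ lam β γ).hamiltonian N x by ring, Real.exp_add]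
      have hE1 := (Real.exp_pos (-1 / T * (pinnedChain ω₂ lam β γ).hamiltonian N x)).le
      calc _ ≤ (M * Cm * Real.exp (ϑ * (pinnedChain ω₂ lam β γ).hamiltonian N x) * Real.exp (-c * s)) *
            (Real.exp (-1 / T * (pinnedChain ω₂ lam β γ).hamiltonian N x) * (1 + x.2 ⟨0, hN⟩ ^ 2 + x.2 ⟨N - 1, by omega⟩ ^ 2)) :=
            mul_le_mul hm (mul_le_mul_of_nonneg_left hp hE1) (by positivity) (by positivity)
        _ = _ := by ring
    calc _ ≤ ∫ x : PhaseSpace N, M * Cm * Real.exp (-c * s) *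
          ((1 + x.2 ⟨0, hN⟩ ^ 2 + x.2 ⟨N - 1, by omega⟩ ^ 2) * Real.exp ((-1 / T + ϑ) * (pinnedChain ω₂ lam β γ).hamiltonian N x)) :=
          norm_integral_le_of_norm_le (hIw.const_mul _) (Eventually.of_forall hbd)
      _ = B' * Real.exp (-c * s) := by rw [integral_const_mul, hB']; ring
  -- integrability on `(0, ∞)` and the limit of the time integral
  have hmeas := measurable_oddMoment_pairing hω hl hβ.le hγ hN hφ2 (T := T) (δ := δ)
  have hIoi : IntegrableOn (fun s : ℝ =>
      ∫ x, (∫ y, φ y ∂((pinnedChain ω₂ lam β γ).transitionKernel N (T + δ / 2) (T - δ / 2) s.toNNReal x)) *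
        (Real.exp (-1 / T * (pinnedChain ω₂ lam β γ).hamiltonian N x) * (x.2 ⟨0, hN⟩ ^ 2 - x.2 ⟨N - 1, by omega⟩ ^ 2))) (Ioi 0) := by
    refine ((exp_neg_integrableOn_Ioi 0 hc).const_mul B').mono' hmeas.aestronglyMeasurable ?_
    rw [ae_restrict_iff' measurableSet_Ioi]
    exact Eventually.of_forall fun s hs => hbound s hs
  have hB : Tendsto (fun t : ℝ≥0 => δ * (γ / (2 * T ^ 2)) * ∫ s in (0 : ℝ)..t,
      ∫ x, (∫ y, φ y ∂((pinnedChain ω₂ lam β γ).transitionKernel N (T + δ / 2) (T - δ / 2) s.toNNReal x)) *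
        (Real.exp (-1 / T * (pinnedChain ω₂ lam β γ).hamiltonian N x) * (x.2 ⟨0, hN⟩ ^ 2 - x.2 ⟨N - 1, by omega⟩ ^ 2))) atTop
      (𝓝 (δ * (γ / (2 * T ^ 2)) * ∫ s in Ioi (0 : ℝ),
        ∫ x, (∫ y, φ y ∂((pinnedChain ω₂ lam β γ).transitionKernel N (T + δ / 2) (T - δ / 2) s.toNNReal x)) *
          (Real.exp (-1 / T * (pinnedChain ω₂ lam β γ).hamiltonian N x) * (x.2 ⟨0, hN⟩ ^ 2 - x.2 ⟨N - 1, by omega⟩ ^ 2)))) :=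
    (intervalIntegral_tendsto_integral_Ioi 0 hIoi (NNReal.tendsto_coe_atTop.2 tendsto_id)).const_mul _
  -- Step C: uniqueness of limits
  exact tendsto_nhds_unique hA' hB

end InfiniteTime

end Summit.AtomisticToContinuum.FouriersLaw.Theorems

end
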